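import Summits.QuantumAdvantage.QuantumAdvantage.Theorems.LinnikCubicClassGroupsDegreeOnePrimesEscapeClassPNTDecayNumerics
import HarnessLib

/-!
# The class prime number theorem with DECAYING error, I′: the Deuring–Heilbronn regime

Topic `Summits/QuantumAdvantage/QuantumAdvantage/Theorems`, cell B2b-1 (linnik-cubic), PART A (gen 32);
helper toward the crux `DegreeOnePrimesEscape` (stmt-QuantumAdvantage-11543) of route
`LinnikCubicClassGroups`.  HONEST FRAMING: the value of this file is a THEOREM (kernel-checked) — NOT
summit progress (the route still rests on the hypothesis-type target `PureCubicClassNumberHard`).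

Sequel of `…ClassPNTDecayNumerics.lean` (decay shape `𝓓_κ(x) = e^{−κ log x/log Q} + e^{−√(κ log x)}`):

* `dhRegime_zeroSum_decay` — the decaying twin of `dhRegime_zeroSum_small` (`…ClassPNTDHNumerics.lean`):
  in the Deuring–Heilbronn regime `2Cnη₁ ≤ 1/3` (`η₁ = (1 − β₁) log x`), with
  `c_Z = min(log(1/(2Cnη₁))/(Cn), a log Q/2)` and `L = log x ≥ a₁ log Q`:
  `A₀ (e^{−c_Z L/(4a log Q)} + e^{−√(c_Z L/4)}) ≤ (6Cn + 1) A₀ · η₁ · 𝓓_κ(x)`, `κ = 1/(32 a (Cn + 1))` —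
  the error is SMALL RELATIVE TO the main term `x − x^{β₁}/β₁ ≍ x η₁` AND decays in `x`
  ([ThornerZaman2019, §5, proof of Thm. 5.1]).

Reference: J. Thorner, A. Zaman, *A unified and improved Chebotarev density theorem*, Algebra Number
Theory 13 (2019), §5 [ThornerZaman2019].
-/

noncomputable section

open Real

namespace Summit.QuantumAdvantage.QuantumAdvantage.Theorems.DegreeOnePrimesEscape

/-! ### The Deuring–Heilbronn regime -/

/-- `1 ≤ log 3`. [folklore] -/
private theorem one_le_log_three : (1 : ℝ) ≤ Real.log 3 := by
  rw [Real.le_log_iff_exp_le (by norm_num)]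
  have := Real.exp_one_lt_d9; linarith

set_option maxHeartbeats 800000 in
/-- **The zero sum in the Deuring–Heilbronn regime, decaying form.**  With `η₁ = (1 − β₁) log x` in the
regime `2Cnη₁ ≤ 1/3`, `η₁ ≥ c₁ e^{−2 log Q}`, and `c_Z = min(log(1/(2Cnη₁))/(Cn), a log Q/2)`, for
`L ≥ a₁ log Q` with `a₁ ≥ 8aCn`, `a₁ ≥ 32Cn + 16Cn·max(0, log(1/(2Cnc₁)))`,
`a₁ ≥ 32 (2 + max(0, log(1/c₁)))²`:
`A₀ (e^{−c_Z L/(4a log Q)} + e^{−√(c_Z L/4)}) ≤ (6Cn + 1) A₀ η₁ (e^{−κL/log Q} + e^{−√(κL)})`,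
`κ = 1/(32 a (Cn + 1))`.  (First alternative of the `min`, `u = 2Cnη₁ ≤ 1/3`, `ℓ = log(1/u) ≥ 1`:
`e^{−ℓm} ≤ u · e · e^{−m}` for `m = L/(4aCn log Q) ≥ 2`, and `√(ℓL/(4Cn)) ≥ ℓ + √(κL)` since
`L ≥ 16Cnℓ`; second alternative: both exponentials are `≤ c₁ e^{−2 log Q} · 𝓓 ≤ η₁ 𝓓`.)
[cite: ThornerZaman2019, §5] -/
theorem dhRegime_zeroSum_decay {A₀ C n η₁ c₁ a lQ L a₁ : ℝ} (hA₀ : 0 < A₀) (hC : 0 < C)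
    (hn : 2 ≤ n) (hc₁ : 0 < c₁) (ha : 1 ≤ a) (hlQ : 1 ≤ lQ) (hη₁0 : 0 < η₁)
    (hη₁low : c₁ * Real.exp (-(2 * lQ)) ≤ η₁) (hη₁C : 2 * C * n * η₁ ≤ 1 / 3)
    (hL : a₁ * lQ ≤ L) (ha₁1 : 8 * a * C * n ≤ a₁)
    (ha₁2 : 32 * C * n + 16 * C * n * max 0 (Real.log (1 / (2 * C * n * c₁))) ≤ a₁)
    (ha₁3 : 32 * (2 + max 0 (Real.log (1 / c₁))) ^ 2 ≤ a₁) :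
    A₀ * (Real.exp (-(min (Real.log (1 / (2 * C * n * η₁)) / (C * n)) (a * lQ / 2) * L / (4 * a * lQ))) +
      Real.exp (-Real.sqrt (min (Real.log (1 / (2 * C * n * η₁)) / (C * n)) (a * lQ / 2) * L / 4))) ≤
      (6 * C * n + 1) * A₀ * η₁ *
        (Real.exp (-(1 / (32 * a * (C * n + 1)) * L / lQ)) +
          Real.exp (-Real.sqrt (1 / (32 * a * (C * n + 1)) * L))) := by
  have hn0 : 0 < n := by linarith
  have hCn : 0 < C * n := mul_pos hC hn0
  have haCn : 0 < 8 * a * C * n := by positivity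
  have ha₁0 : 0 < a₁ := lt_of_lt_of_le haCn ha₁1
  have hlQ0 : 0 < lQ := by linarith
  set κ : ℝ := 1 / (32 * a * (C * n + 1)) with hκ
  have hκ0 : 0 < κ := by positivity
  have hκ1 : κ ≤ 1 / (4 * a * (C * n)) := by
    rw [hκ]; exact one_div_le_one_div_of_le (by positivity) (by nlinarith)
  have hκ2 : κ ≤ 1 / (16 * (C * n)) := by
    rw [hκ]; exact one_div_le_one_div_of_le (by positivity) (by nlinarith)
  have hκ3 : κ ≤ 1 / 32 := by
    rw [hκ]; exact one_div_le_one_div_of_le (by positivity) (by nlinarith)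
  set u : ℝ := 2 * C * n * η₁ with hu
  have hu0 : 0 < u := by positivity
  have hu3 : u ≤ 1 / 3 := hη₁C
  set ℓ : ℝ := Real.log (1 / u) with hℓ
  have hℓ1 : 1 ≤ ℓ := by
    rw [hℓ]
    refine one_le_log_three.trans (Real.log_le_log (by norm_num) ?_)
    rw [le_div_iff₀ hu0]; linarith
  have hℓ0 : 0 ≤ ℓ := by linarith
  have heℓ : Real.exp (-ℓ) = u := by
    rw [hℓ, Real.exp_neg, Real.exp_log (by positivity), one_div, inv_inv]
  have hLa₁ : a₁ ≤ L := by
    have : a₁ * 1 ≤ a₁ * lQ := mul_le_mul_of_nonneg_left hlQ ha₁0.le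
    linarith
  have hL0 : 0 < L := by linarith
  have hD0 : 0 < Real.exp (-(κ * L / lQ)) + Real.exp (-Real.sqrt (κ * L)) := by positivity
  -- the decay shape dominates `e^{-κ L}`
  have hκL : Real.exp (-(κ * L)) ≤ Real.exp (-(κ * L / lQ)) := exp_neg_mul_le_exp_neg_div hκ0.le hL0.le hlQ
  rcases le_total (ℓ / (C * n)) (a * lQ / 2) with hcase | hcase
  · -- first alternative: `c_Z = ℓ/(Cn)`
    rw [min_eq_left hcase]
    -- `ℓ ≤ 2 lQ + κ₁`
    set κ₁ : ℝ := max 0 (Real.log (1 / (2 * C * n * c₁))) with hκ₁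
    have hκ₁0 : 0 ≤ κ₁ := le_max_left _ _
    have hℓle : ℓ ≤ 2 * lQ + κ₁ := by
      have h1 : 1 / u ≤ Real.exp (2 * lQ) / (2 * C * n * c₁) := by
        rw [hu, div_le_div_iff₀ hu0 (by positivity), one_mul]
        have := mul_le_mul_of_nonneg_left hη₁low (by positivity : (0 : ℝ) ≤ 2 * C * n)
        calc 2 * C * n * c₁ = 2 * C * n * (c₁ * Real.exp (-(2 * lQ))) * Real.exp (2 * lQ) := by
              rw [Real.exp_neg]; field_simp
          _ ≤ 2 * C * n * η₁ * Real.exp (2 * lQ) := mul_le_mul_of_nonneg_right this (by positivity)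
          _ = Real.exp (2 * lQ) * (2 * C * n * η₁) := by ring
      have h2 : ℓ ≤ Real.log (Real.exp (2 * lQ) / (2 * C * n * c₁)) :=
        Real.log_le_log (by positivity) h1
      rw [Real.log_div (by positivity) (by positivity), Real.log_exp] at h2
      have h3 : -Real.log (2 * C * n * c₁) ≤ κ₁ := by
        rw [← Real.log_inv, ← one_div]; exact le_max_right _ _
      linarith
    -- `L ≥ 16 C n ℓ` and `L ≥ 8 a C n lQ`
    have hL16 : 16 * (C * n) * ℓ ≤ L := by
      have h1 : 16 * (C * n) * ℓ ≤ 16 * (C * n) * (2 * lQ + κ₁) :=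
        mul_le_mul_of_nonneg_left hℓle (by positivity)
      have h2 : (32 * C * n + 16 * C * n * κ₁) * lQ ≤ a₁ * lQ :=
        mul_le_mul_of_nonneg_right ha₁2 (by linarith)
      have h3 : 16 * C * n * κ₁ * 1 ≤ 16 * C * n * κ₁ * lQ :=
        mul_le_mul_of_nonneg_left hlQ (by positivity)
      have e1 : 16 * (C * n) * (2 * lQ + κ₁) = 32 * C * n * lQ + 16 * C * n * κ₁ := by ring
      have e2 : (32 * C * n + 16 * C * n * κ₁) * lQ = 32 * C * n * lQ + 16 * C * n * κ₁ * lQ := by ring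
      linarith
    have hL8 : 2 * (4 * a * lQ * (C * n)) ≤ L := by
      have h1 := mul_le_mul_of_nonneg_right ha₁1 (by linarith : (0 : ℝ) ≤ lQ)
      have e : 2 * (4 * a * lQ * (C * n)) = 8 * a * C * n * lQ := by ring
      linarith
    -- first exponential: `e^{-ℓ m} ≤ u e e^{-m}`, `m = L/(4 a C n lQ) ≥ 2`, and `e^{-m} ≤ e^{-κ L/lQ}`
    set m : ℝ := L / (4 * a * lQ * (C * n)) with hm
    have hm2 : 2 ≤ m := by rw [hm, le_div_iff₀ (by positivity)]; exact hL8
    have hE1 : Real.exp (-(ℓ / (C * n) * L / (4 * a * lQ))) ≤ u * (Real.exp 1 * Real.exp (-(κ * L / lQ))) := by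
      have e1 : ℓ / (C * n) * L / (4 * a * lQ) = ℓ * m := by rw [hm]; field_simp
      rw [e1]
      have h1 : ℓ + (m - 1) ≤ ℓ * m := by nlinarith
      have h2 : Real.exp (-(ℓ * m)) ≤ Real.exp (-ℓ) * Real.exp (-(m - 1)) := by
        rw [← Real.exp_add, Real.exp_le_exp]; linarith
      have h3 : Real.exp (-(m - 1)) = Real.exp 1 * Real.exp (-m) := by
        rw [← Real.exp_add]; ring_nf
      have h4 : Real.exp (-m) ≤ Real.exp (-(κ * L / lQ)) := by
        rw [Real.exp_le_exp, neg_le_neg_iff, hm]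
        rw [show κ * L / lQ = κ * (4 * a * (C * n)) * (L / (4 * a * lQ * (C * n))) by field_simp]
        have : κ * (4 * a * (C * n)) ≤ 1 := by
          have := (le_div_iff₀ (by positivity : (0:ℝ) < 4 * a * (C * n))).1 hκ1
          linarith
        have hq : 0 ≤ L / (4 * a * lQ * (C * n)) := by positivity
        nlinarith
      rw [heℓ, h3] at h2
      calc Real.exp (-(ℓ * m)) ≤ u * (Real.exp 1 * Real.exp (-m)) := h2
        _ ≤ u * (Real.exp 1 * Real.exp (-(κ * L / lQ))) :=
            mul_le_mul_of_nonneg_left (mul_le_mul_of_nonneg_left h4 (Real.exp_pos _).le) hu0.le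
    -- second exponential: `√(ℓ L/(4Cn)) ≥ ℓ + √(κ L)`
    have hE2 : Real.exp (-Real.sqrt (ℓ / (C * n) * L / 4)) ≤ u * Real.exp (-Real.sqrt (κ * L)) := by
      -- `ℓ + √(κ L) ≤ √(ℓ L /(4Cn))`
      have hS : ℓ + Real.sqrt (κ * L) ≤ Real.sqrt (ℓ / (C * n) * L / 4) := by
        have e1 : ℓ / (C * n) * L / 4 = ℓ * (L / (4 * (C * n))) := by field_simp
        rw [e1]
        -- `2ℓ ≤ √` and `2√(κL) ≤ √`
        have hA : (2 * ℓ) ^ 2 ≤ ℓ * (L / (4 * (C * n))) := by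
          have h2 : 4 * ℓ ≤ L / (4 * (C * n)) := by
            rw [le_div_iff₀ (by positivity)]
            have e : 4 * ℓ * (4 * (C * n)) = 16 * (C * n) * ℓ := by ring
            linarith
          have := mul_le_mul_of_nonneg_left h2 hℓ0
          nlinarith
        have hB : (2 * Real.sqrt (κ * L)) ^ 2 ≤ ℓ * (L / (4 * (C * n))) := by
          rw [mul_pow, Real.sq_sqrt (by positivity)]
          have h2 : 4 * κ ≤ 1 / (4 * (C * n)) := by
            have := hκ2
            rw [show 1 / (16 * (C * n)) = 1 / (4 * (C * n)) / 4 by field_simp; ring] at this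
            linarith
          have h3 : 4 * κ * L ≤ 1 * (L / (4 * (C * n))) := by
            rw [one_mul, le_div_iff₀ (by positivity)]
            have := mul_le_mul_of_nonneg_right h2 hL0.le
            rw [div_mul_eq_mul_div, le_div_iff₀ (by positivity)] at this
            linarith
          have h4 : 1 * (L / (4 * (C * n))) ≤ ℓ * (L / (4 * (C * n))) :=
            mul_le_mul_of_nonneg_right hℓ1 (by positivity)
          linarith
        have hA' : 2 * ℓ ≤ Real.sqrt (ℓ * (L / (4 * (C * n)))) := Real.le_sqrt_of_sq_le hA
        have hB' : 2 * Real.sqrt (κ * L) ≤ Real.sqrt (ℓ * (L / (4 * (C * n)))) := Real.le_sqrt_of_sq_le hB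
        linarith
      rw [← heℓ, ← Real.exp_add, Real.exp_le_exp]
      linarith
    -- assemble: `A₀ (u e 𝓓₁ + u 𝓓₂) ≤ 6 C n A₀ η₁ 𝓓 ≤ (6Cn+1) A₀ η₁ 𝓓`
    have he3 : Real.exp 1 ≤ 3 := by have := Real.exp_one_lt_d9; linarith
    have hD1 : 0 < Real.exp (-(κ * L / lQ)) := Real.exp_pos _
    have hD2 : 0 < Real.exp (-Real.sqrt (κ * L)) := Real.exp_pos _
    calc A₀ * (Real.exp (-(ℓ / (C * n) * L / (4 * a * lQ))) + Real.exp (-Real.sqrt (ℓ / (C * n) * L / 4)))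
        ≤ A₀ * (u * (Real.exp 1 * Real.exp (-(κ * L / lQ))) + u * Real.exp (-Real.sqrt (κ * L))) :=
          mul_le_mul_of_nonneg_left (add_le_add hE1 hE2) hA₀.le
      _ ≤ A₀ * (u * (3 * Real.exp (-(κ * L / lQ))) + u * (3 * Real.exp (-Real.sqrt (κ * L)))) := by
          refine mul_le_mul_of_nonneg_left (add_le_add ?_ ?_) hA₀.le
          · exact mul_le_mul_of_nonneg_left (mul_le_mul_of_nonneg_right he3 hD1.le) hu0.le
          · refine mul_le_mul_of_nonneg_left ?_ hu0.le
            linarith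
      _ = 6 * C * n * A₀ * η₁ * (Real.exp (-(κ * L / lQ)) + Real.exp (-Real.sqrt (κ * L))) := by
          rw [hu]; ring
      _ ≤ (6 * C * n + 1) * A₀ * η₁ * (Real.exp (-(κ * L / lQ)) + Real.exp (-Real.sqrt (κ * L))) := by
          have h0 : 0 ≤ A₀ * η₁ * (Real.exp (-(κ * L / lQ)) + Real.exp (-Real.sqrt (κ * L))) := by
            positivity
          have e : (6 * C * n + 1) * A₀ * η₁ * (Real.exp (-(κ * L / lQ)) + Real.exp (-Real.sqrt (κ * L))) =
              6 * C * n * A₀ * η₁ * (Real.exp (-(κ * L / lQ)) + Real.exp (-Real.sqrt (κ * L))) +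
                A₀ * η₁ * (Real.exp (-(κ * L / lQ)) + Real.exp (-Real.sqrt (κ * L))) := by ring
          linarith
  · -- second alternative: `c_Z = a lQ / 2`
    rw [min_eq_right hcase]
    set Λ : ℝ := max 0 (Real.log (1 / c₁)) with hΛ
    have hΛ0 : 0 ≤ Λ := le_max_left _ _
    -- `e^{-Λ} ≤ c₁`
    have heΛ : Real.exp (-Λ) ≤ c₁ := by
      rw [Real.exp_neg]
      have h1 : 1 / c₁ ≤ Real.exp Λ := by
        calc 1 / c₁ = Real.exp (Real.log (1 / c₁)) := (Real.exp_log (by positivity)).symm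
          _ ≤ Real.exp Λ := Real.exp_le_exp.2 (le_max_right _ _)
      calc (Real.exp Λ)⁻¹ ≤ (1 / c₁)⁻¹ := inv_anti₀ (by positivity) h1
        _ = c₁ := by rw [one_div, inv_inv]
    -- `e^{-(2+Λ) lQ} ≤ η₁`
    have hE : Real.exp (-((2 + Λ) * lQ)) ≤ η₁ := by
      have h1 : Real.exp (-((2 + Λ) * lQ)) ≤ Real.exp (-(2 * lQ)) * Real.exp (-Λ) := by
        rw [← Real.exp_add, Real.exp_le_exp]
        have : Λ * 1 ≤ Λ * lQ := mul_le_mul_of_nonneg_left hlQ hΛ0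
        linarith
      refine h1.trans ?_
      calc Real.exp (-(2 * lQ)) * Real.exp (-Λ) ≤ Real.exp (-(2 * lQ)) * c₁ :=
            mul_le_mul_of_nonneg_left heΛ (by positivity)
        _ = c₁ * Real.exp (-(2 * lQ)) := by ring
        _ ≤ η₁ := hη₁low
    have h2Λ : 2 ≤ 2 + Λ := by linarith
    have ha₁' : 16 * (2 + Λ) ≤ a₁ := by
      have : (2 + Λ) ≤ (2 + Λ) ^ 2 := by nlinarith
      nlinarith
    -- first exponential: `e^{-L/8} = e^{-L/16} e^{-L/16} ≤ η₁ e^{-κ L/lQ}`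
    have hE1 : Real.exp (-(a * lQ / 2 * L / (4 * a * lQ))) ≤ η₁ * Real.exp (-(κ * L / lQ)) := by
      rw [show a * lQ / 2 * L / (4 * a * lQ) = L / 16 + L / 16 by field_simp; ring, neg_add, Real.exp_add]
      refine mul_le_mul ?_ ?_ (Real.exp_pos _).le hη₁0.le
      · refine le_trans (Real.exp_le_exp.2 ?_) hE
        have h1 : 16 * (2 + Λ) * lQ ≤ a₁ * lQ := mul_le_mul_of_nonneg_right ha₁' (by linarith)
        nlinarith
      · refine le_trans (Real.exp_le_exp.2 ?_) hκL
        have : κ * L ≤ 1 / 32 * L := mul_le_mul_of_nonneg_right hκ3 hL0.le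
        linarith
    -- second exponential: `√(a lQ L / 8) ≥ (2+Λ) lQ + √(κ L)`
    have hE2 : Real.exp (-Real.sqrt (a * lQ / 2 * L / 4)) ≤ η₁ * Real.exp (-Real.sqrt (κ * L)) := by
      have hS : (2 + Λ) * lQ + Real.sqrt (κ * L) ≤ Real.sqrt (a * lQ / 2 * L / 4) := by
        have hmono : Real.sqrt (lQ * L / 8) ≤ Real.sqrt (a * lQ / 2 * L / 4) := by
          refine Real.sqrt_le_sqrt ?_
          rw [show a * lQ / 2 * L / 4 = a * (lQ * L / 8) by ring]
          have h0 : 0 ≤ lQ * L / 8 := by positivity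
          nlinarith
        have hA : (2 * ((2 + Λ) * lQ)) ^ 2 ≤ lQ * L / 8 := by
          have h3 : 32 * (2 + Λ) ^ 2 * lQ ≤ a₁ * lQ := mul_le_mul_of_nonneg_right ha₁3 (by linarith)
          have h4 : a₁ * lQ * lQ ≤ L * lQ := mul_le_mul_of_nonneg_right hL (by linarith)
          nlinarith
        have hB : (2 * Real.sqrt (κ * L)) ^ 2 ≤ lQ * L / 8 := by
          rw [mul_pow, Real.sq_sqrt (by positivity)]
          have : κ * L ≤ 1 / 32 * L := mul_le_mul_of_nonneg_right hκ3 hL0.le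
          have : 1 * L ≤ lQ * L := mul_le_mul_of_nonneg_right hlQ hL0.le
          nlinarith
        have hA' := Real.le_sqrt_of_sq_le hA
        have hB' := Real.le_sqrt_of_sq_le hB
        linarith
      have h1 : Real.exp (-Real.sqrt (a * lQ / 2 * L / 4)) ≤
          Real.exp (-((2 + Λ) * lQ)) * Real.exp (-Real.sqrt (κ * L)) := by
        rw [← Real.exp_add, Real.exp_le_exp]; linarith
      exact h1.trans (mul_le_mul_of_nonneg_right hE (Real.exp_pos _).le)
    calc A₀ * (Real.exp (-(a * lQ / 2 * L / (4 * a * lQ))) + Real.exp (-Real.sqrt (a * lQ / 2 * L / 4)))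
        ≤ A₀ * (η₁ * Real.exp (-(κ * L / lQ)) + η₁ * Real.exp (-Real.sqrt (κ * L))) :=
          mul_le_mul_of_nonneg_left (add_le_add hE1 hE2) hA₀.le
      _ = 1 * A₀ * η₁ * (Real.exp (-(κ * L / lQ)) + Real.exp (-Real.sqrt (κ * L))) := by ring
      _ ≤ (6 * C * n + 1) * A₀ * η₁ * (Real.exp (-(κ * L / lQ)) + Real.exp (-Real.sqrt (κ * L))) := by
          refine mul_le_mul_of_nonneg_right (mul_le_mul_of_nonneg_right
            (mul_le_mul_of_nonneg_right (by nlinarith) hA₀.le) hη₁0.le) hD0.le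

end Summit.QuantumAdvantage.QuantumAdvantage.Theorems.DegreeOnePrimesEscape

end
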